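import Literature.AlgebraicGeometry.HodgeTheory.PolarizedLimitMixedHodgeStructureApproximateIntegralHodgeClasses
import HarnessLib

/-!
# One-variable period maps in asymptotic normal form `Φ(z) = exp(zN)·G(z)·F`: proximity to the nilpotent orbit, `Φ(z) ∈ D` for
# `Im z ≫ 0`, and Cattani–Deligne–Kaplan's Theorem 2.5 for such period maps

Topic `Literature/AlgebraicGeometry/HodgeTheory` (namespace `…HodgeTheory.PolarizedLimitMixedHodgeStructure`).  Theorems only; no
definition, no structure, no instance, no named fact (D-0026 net debt `0`): the period map is carried by EXPLICIT HYPOTHESES on a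
family of endomorphisms `G(z)` of `V_ℂ` (see below), so that every statement is a theorem about all such families.

PRINTED SOURCE, VERBATIM. E. Cattani, P. Deligne, A. Kaplan, *On the locus of Hodge classes*, J. Amer. Math. Soc. 8 (1995) 483–506.
**2.3** (p. 487): «When pulled back to `ℋʳ`, the variation can be described as a variable Hodge filtration `Φ(z)` on the fixed vector
space `V = V_ℤ ⊗ ℂ`, with `Φ(z + e_j) = exp(N_j)Φ(z)` … (2.3.1) `Φ(z) = exp(Σ z_jN_j) Ψ(s)` (`s = e^{2πiz}`) for some holomorphic map `Ψ`
from `Dʳ` to the flag manifold of `V`. The nilpotent orbit is given by `Φ_nil(z) = exp(Σ z_jN_j) Ψ(0)`. Statements (2.2.2) and (2.2.3)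
translate as the existence of constants `C₀, C₂, C₃` … as soon as `inf(y) ≥ C₂`, (2.3.2) `Φ_nil(z)` defines a Hodge structure on `V`.
(2.3.3) The distance between `Φ(z)` and `Φ_nil(z)`, measured as in (2.2.3), is `≤ C₃ e^{−2π inf(y)} inf(y)^{C₀}`.»  **2.7** (p. 489):
«(2.7.1) `Φ(z) = exp(Σ z_jN_j) exp(Γ(s)) F` with `Γ` holomorphic at `s = 0`, `𝔟`-valued, and such that `Γ(0) = 0`.»  **Theorem 2.5**
(p. 488): «Given `K`, there is a constant `A₁` … (i) There are only finitely many `v ∈ V_ℤ` such that `Q(v, v) ≤ K` and `v ∈ Φ⁰(z)` at some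
point `z` with `0 ≤ x_i ≤ 1` and `inf(y_i) ≥ A₁`. (ii) Any such `v` is in `W₀`, as well as in `F_v⁰` for some limiting Hodge filtration
`F_v`.»  **2.18** (p. 492): «For `inf(y_j)` large, `Φ(z)` and `Φ_nil(z)` are close — roughly at a distance `exp(−2π inf(y_j))` … On the
other hand, `exp(Σ z_jN_j)` is of size `sup(y_j)^k` … If the `y_j` are of wildly different magnitudes, the product need not be small»
(no such difficulty for `r = 1`).

THE HYPOTHESES (one variable, `r = 1`).  `L = (W, F, N, Q)` is a polarized limit mixed Hodge structure of weight `k` on the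
finite-dimensional `ℚ`-space `V` with nilpotent orbit `θ(z) = exp(zN)·F = Φ_nil(z)` (`Im z > β`), `|·|₀` the reference norm.  A PERIOD
MAP IN ASYMPTOTIC NORMAL FORM is given by `G : ℂ → End(V_ℂ)` (the printed `exp Γ(s)`, `s = e^{2πiz}`, as a function of `z`) with
**`|G(z)w − w|₀ ≤ C e^{−γ Im z}|w|₀` for `Im z ≥ A₀`** (`γ = 2π` and `Γ(0) = 0`, `Γ` holomorphic, in the source; holomorphy and the
periodicity in `Re z` are not used) and, where `Φ(z) ∈ D` is wanted, **`Q_ℂ(G(z)x, G(z)y) = Q_ℂ(x, y)`** (`Γ(s) ∈ 𝔤`).  Its Hodge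
filtration is **`Φ^q(z) := exp(zN)·G(z)·F^q`** — written `((L.F q).map (G z)).map (exp(zN_ℂ))` throughout.

WHAT IS FORMALIZED.
* §1 «`exp(zN)` is of size `y^k`» against «distance `exp(−2πy)`» (2.18, harmless for `r = 1`): with `g_z = exp(zN)G(z)exp(−zN)`,
  **`‖g_z w − w‖_{θ(z)} ≤ D (Im z)^m e^{−γ Im z} ‖w‖_{θ(z)}`** for `|Re z| ≤ R` (`exists_forall_hodgeNorm_conj_sub_le`).
* §2 `Φ^q(z) = g_z·θ(z)^q` (`map_exp_map_eq_map_conj_nilpotentOrbit_F`).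
* §3 **(2.3.2) for `Φ`: `Φ(z) ∈ D` for `Im z ≥ A`** — there is a Hodge structure of weight `k` on `V` with Hodge filtration `Φ(z)`,
  polarized by `Q` (`exists_forall_exists_hodgeStructure_polarization_periodMap`; the openness of `D`, the tree's
  `Polarization.exists_hodgeStructure_polarization_of_hodgeNorm_sub_le`, at the point `θ(z) ∈ D`).
* §4 **(2.3.3): every `v ∈ Φ^p(z)` is within `2D (Im z)^m e^{−γ Im z}‖v‖_{θ(z)} ≤ e^{−(γ/2) Im z}‖v‖_{θ(z)}` of `F^pθ(z)`** in the Hodge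
  metric of `θ(z)` (`exists_forall_exists_mem_nilpotentOrbit_F_hodgeNorm_sub_le(_exp)`) — exact Hodge classes of `Φ` are approximate
  Hodge classes of `Φ_nil` in the sense of 2.15.
* §5 **CDK THEOREM 2.5 FOR THE PERIOD MAP `Φ`, `r = 1`** (`exists_threshold_integral_hodgeClasses_periodMap`): for `k = p + p`, `Λ ⊆ V`
  finitely generated, `K`, `R`: there is `A₁` such that every `u ∈ Λ` with `Q(u, u) ≤ K` which lies in `Φ^p(z)` (i.e. is of type `(p,p)`
  for `Φ(z)`, `u` being real) at SOME `z` with `Im z ≥ A₁`, `|Re z| ≤ R` satisfies: `u ∈ W_k`, `N u = 0`, `1 ⊗ u ∈ F^p` («in `F_v⁰` for some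
  limiting Hodge filtration»), `u ∈ H^{p,p}(θ(z'))` for every `z'`; and (i) these `u` are FINITE in number — by Thm. 2.16 for the nilpotent
  orbit (`…ApproximateIntegralHodgeClasses`) with `α = γ/2` and `‖1 ⊗ u‖_{θ(z)} ≤ √(3K)` (2.17 (iii)).

NOT HERE: Schmid's nilpotent orbit theorem itself (that every one-variable variation with unipotent monodromy has this normal form,
[Schmid1973, (4.9)/(4.12)], [CattaniKaplanSchmid1986]); Remark 2.6 / 2.13 (`|z' − z| < A₂ e^{−2π y}`); several variables; 1.1–1.5.

## References

* [CattaniDeligneKaplan1995] E. Cattani, P. Deligne, A. Kaplan, *On the locus of Hodge classes*, J. Amer. Math. Soc. 8 (1995)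
  483–506: 2.2–2.3 ((2.3.1)–(2.3.3), p. 487), Thm. 2.5 (p. 488), 2.7 (2.7.1) (p. 489), 2.15–2.19 (pp. 491–493), §4 (pp. 499–505).
* [Schmid1973] W. Schmid, *Variation of Hodge structure: the singularities of the period mapping*, Invent. Math. 22 (1973): (4.9),
  (4.12) nilpotent orbit theorem (cite only).
* [CattaniKaplanSchmid1986] E. Cattani, A. Kaplan, W. Schmid, Ann. of Math. 123 (1986): (1.15) (cite only).
* [CarlsonMullerStachPeters2017] J. Carlson, S. Müller-Stach, C. Peters, *Period Mappings and Period Domains* (2nd ed. 2017): Prop. 4.4.2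
  (`D` open in `Ď`).
-/

noncomputable section

open scoped TensorProduct ComplexOrder
open Filter Topology

namespace Literature.AlgebraicGeometry

open Module
open Motives Motives.MixedHodgeStructure Motives.HodgeStructure
open Motives.HodgeStructure (conj ofRat ofRat_apply conj_ofRat)

universe u

variable {V : Type u} [AddCommGroup V] [Module ℚ V] [FiniteDimensional ℚ V] {k : ℤ}

namespace HodgeTheory

namespace PolarizedLimitMixedHodgeStructure

variable (L : PolarizedLimitMixedHodgeStructure V k)

/-! ## §0 Tools -/

/-- `y ↦ y^n e^{−αy}` tends to `0` at `+∞` (`α > 0`). [folklore] -/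
private theorem tendsto_pow_mul_exp_neg_mul' {α : ℝ} (hα : 0 < α) (n : ℕ) :
    Tendsto (fun y : ℝ => y ^ n * Real.exp (-α * y)) atTop (𝓝 0) := by
  have h := ((Real.tendsto_pow_mul_exp_neg_atTop_nhds_zero n).comp (tendsto_id.const_mul_atTop hα)).const_mul ((α ^ n)⁻¹)
  rw [mul_zero] at h
  refine h.congr fun y => ?_
  simp only [Function.comp_apply, id_eq, mul_pow]
  field_simp

/-- An explicit threshold: `y^n e^{−αy} ≤ ε` for `y ≥ A`. [folklore] -/
private theorem exists_forall_pow_mul_exp_le' {α : ℝ} (hα : 0 < α) (n : ℕ) {ε : ℝ} (hε : 0 < ε) :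
    ∃ A : ℝ, ∀ y : ℝ, A ≤ y → y ^ n * Real.exp (-α * y) ≤ ε := by
  have h := (tendsto_pow_mul_exp_neg_mul' hα n).eventually (Iic_mem_nhds hε)
  obtain ⟨A, hA⟩ := eventually_atTop.1 h
  exact ⟨A, fun y hy => hA y hy⟩

/-- `exp(−(z•N)) = exp((−z)•N)`. [folklore] -/
private theorem neg_smul_N (z : ℂ) : -(z • L.N.baseChange ℂ) = (-z) • L.N.baseChange ℂ := (neg_smul _ _).symm

/-! ## §1 The conjugated perturbation `g_z = exp(zN) G(z) exp(−zN)` is close to `1` in the Hodge metric of `θ(z)` -/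

/-- **`‖g_z w − w‖_{θ(z)} ≤ D (Im z)^m e^{−γ Im z} ‖w‖_{θ(z)}` for `g_z = exp(zN)G(z)exp(−zN)`, all `w`, all `z` with `Im z > β`,
`Im z ≥ A₀`, `|Re z| ≤ R`** — the perturbation `G(z)` («distance `≈ exp(−2π inf y)`») conjugated by `exp(zN)` («of size `sup(y)^k`») and
measured in the Hodge metric (polynomial distortion, 2.16 Remark (ii)) is still exponentially close to the identity: for `r = 1` the
product `e^{−γy}·y^m` IS small. [cite: CattaniDeligneKaplan1995, 2.3 (2.3.3) and 2.18 (pp. 487, 492)] [cite: Schmid1973, (4.12) (cite only)] -/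
theorem exists_forall_hodgeNorm_conj_sub_le (G : ℂ → Module.End ℂ (ℂ ⊗[ℚ] V)) {C γ A₀ : ℝ} (hC : 0 ≤ C)
    (hG : ∀ z : ℂ, A₀ ≤ z.im → ∀ w, L.referenceNorm (G z w - w) ≤ C * Real.exp (-γ * z.im) * L.referenceNorm w) (R : ℝ) :
    ∃ D : ℝ, 0 ≤ D ∧ ∃ m : ℕ, ∀ (z : ℂ) (hz : L.normThreshold < z.im), A₀ ≤ z.im → |z.re| ≤ R → ∀ w : ℂ ⊗[ℚ] V,
      (L.nilpotentOrbitPolarization z (L.orbitThreshold_lt_im hz)).hodgeNorm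
          ((IsNilpotent.exp (z • L.N.baseChange ℂ) * G z * IsNilpotent.exp (-(z • L.N.baseChange ℂ))) w - w) ≤
        D * z.im ^ m * Real.exp (-γ * z.im) * (L.nilpotentOrbitPolarization z (L.orbitThreshold_lt_im hz)).hodgeNorm w := by
  obtain ⟨M, hM0, d, hM⟩ := L.exists_referenceNorm_exp_smul_N_le
  obtain ⟨B₁, hB₁, n₁, h₁⟩ := L.exists_forall_hodgeNorm_nilpotentOrbit_le_pow_mul_referenceNorm R
  obtain ⟨B₂, hB₂, n₂, h₂⟩ := L.exists_forall_referenceNorm_le_pow_mul_hodgeNorm_nilpotentOrbit R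
  refine ⟨B₁ * B₂ * M * M * C * ((2 + |R|) ^ d * (2 + |R|) ^ d), by positivity, n₁ + (d + d) + n₂, fun z hz hA₀ hRz w => ?_⟩
  have hz0 : 0 < z.im := L.im_pos_of_normThreshold_lt hz
  have hy1 : 1 ≤ z.im := L.one_le_im_of_normThreshold_lt hz
  set y := z.im with hy_def
  set Pz := L.nilpotentOrbitPolarization z (L.orbitThreshold_lt_im hz) with hPz_def
  set E := IsNilpotent.exp (z • L.N.baseChange ℂ) with hE_def
  set E' := IsNilpotent.exp (-(z • L.N.baseChange ℂ)) with hE'_def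
  set a := E' w with ha_def
  -- `g w − w = E (G a − a)`
  have hEa : E a = w := by
    rw [ha_def, ← Module.End.mul_apply, hE_def, hE'_def, IsNilpotent.exp_mul_exp_neg_self (L.isNilpotent_N_baseChange.smul _),
      Module.End.one_apply]
  have hsplit : (E * G z * E') w - w = E (G z a - a) := by
    rw [Module.End.mul_apply, Module.End.mul_apply, ← ha_def, map_sub, hEa]
  -- norms of `z`
  have hnz : ‖z‖ ≤ |R| + y := by
    calc ‖z‖ ≤ |z.re| + |z.im| := Complex.norm_le_abs_re_add_abs_im z
      _ ≤ |R| + y := by rw [abs_of_pos hz0]; linarith [hRz.trans (le_abs_self R)]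
  have hpoly : (1 + ‖z‖) ^ d ≤ (2 + |R|) ^ d * y ^ d := by
    rw [← mul_pow]
    refine pow_le_pow_left₀ (by positivity) ?_ d
    nlinarith [abs_nonneg R]
  have hpoly' : (1 + ‖-z‖) ^ d ≤ (2 + |R|) ^ d * y ^ d := by rw [norm_neg]; exact hpoly
  -- the chain of estimates in the fixed norm
  have hstep1 : L.referenceNorm (E (G z a - a)) ≤ M * (1 + ‖z‖) ^ d * L.referenceNorm (G z a - a) := hM z _
  have hstep2 : L.referenceNorm (G z a - a) ≤ C * Real.exp (-γ * y) * L.referenceNorm a := hG z hA₀ a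
  have hstep3 : L.referenceNorm a ≤ M * (1 + ‖-z‖) ^ d * L.referenceNorm w := by
    have h := hM (-z) w
    rwa [← L.neg_smul_N] at h
  have hstep4 : L.referenceNorm w ≤ B₂ * y ^ n₂ * Pz.hodgeNorm w := h₂ z hz hRz w
  have hstep0 : Pz.hodgeNorm (E (G z a - a)) ≤ B₁ * y ^ n₁ * L.referenceNorm (E (G z a - a)) := h₁ z hz hRz _
  rw [hsplit]
  have h0w := Pz.hodgeNorm_nonneg w
  calc Pz.hodgeNorm (E (G z a - a)) ≤ B₁ * y ^ n₁ * L.referenceNorm (E (G z a - a)) := hstep0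
    _ ≤ B₁ * y ^ n₁ * (M * (1 + ‖z‖) ^ d * (C * Real.exp (-γ * y) * (M * (1 + ‖-z‖) ^ d * (B₂ * y ^ n₂ * Pz.hodgeNorm w)))) := by
        refine mul_le_mul_of_nonneg_left (hstep1.trans (mul_le_mul_of_nonneg_left (hstep2.trans
          (mul_le_mul_of_nonneg_left (hstep3.trans (mul_le_mul_of_nonneg_left hstep4 (by positivity))) (by positivity)))
          (by positivity))) (by positivity)
    _ ≤ B₁ * y ^ n₁ * (M * ((2 + |R|) ^ d * y ^ d) * (C * Real.exp (-γ * y) * (M * ((2 + |R|) ^ d * y ^ d) * (B₂ * y ^ n₂ * Pz.hodgeNorm w)))) := by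
        gcongr
    _ = B₁ * B₂ * M * M * C * ((2 + |R|) ^ d * (2 + |R|) ^ d) * y ^ (n₁ + (d + d) + n₂) * Real.exp (-γ * y) * Pz.hodgeNorm w := by
        rw [pow_add, pow_add, pow_add]; ring

/-! ## §2 The Hodge filtration of the period map: `Φ^q(z) = exp(zN)·G(z)·F^q = g_z·θ(z)^q` -/

/-- **`Φ^q(z) = g_z·θ(z)^q`**: `exp(zN)·G(z)·F^q = (exp(zN)G(z)exp(−zN))·(exp(zN)·F^q)`.
[cite: CattaniDeligneKaplan1995, 2.3 (2.3.1) and 2.7 (2.7.1) (pp. 487, 489)] -/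
theorem map_exp_map_eq_map_conj_nilpotentOrbit_F (G : ℂ → Module.End ℂ (ℂ ⊗[ℚ] V)) {z : ℂ} (hz : L.orbitThreshold < z.im) (q : ℤ) :
    ((L.F q).map (G z)).map (IsNilpotent.exp (z • L.N.baseChange ℂ)) =
      ((L.nilpotentOrbit z hz).F q).map
        (IsNilpotent.exp (z • L.N.baseChange ℂ) * G z * IsNilpotent.exp (-(z • L.N.baseChange ℂ))) := by
  rw [L.nilpotentOrbit_F, ← Submodule.map_comp, ← Submodule.map_comp, ← Module.End.mul_eq_comp, ← Module.End.mul_eq_comp,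
    mul_assoc, IsNilpotent.exp_neg_mul_exp_self (L.isNilpotent_N_baseChange.smul _), mul_one]

/-- `g_z` preserves `Q_ℂ` when `G(z)` does (`exp(±zN) ∈ G_ℂ`). [cite: CattaniDeligneKaplan1995, 2.7 ("the N_j … lie in 𝔤") (p. 489)] -/
theorem Q_baseChange_conj_apply (G : ℂ → Module.End ℂ (ℂ ⊗[ℚ] V)) (hGQ : ∀ z x y, L.Q.baseChange ℂ (G z x) (G z y) = L.Q.baseChange ℂ x y)
    (z : ℂ) (x y : ℂ ⊗[ℚ] V) :
    L.Q.baseChange ℂ ((IsNilpotent.exp (z • L.N.baseChange ℂ) * G z * IsNilpotent.exp (-(z • L.N.baseChange ℂ))) x)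
      ((IsNilpotent.exp (z • L.N.baseChange ℂ) * G z * IsNilpotent.exp (-(z • L.N.baseChange ℂ))) y) = L.Q.baseChange ℂ x y := by
  rw [Module.End.mul_apply, Module.End.mul_apply, Module.End.mul_apply, Module.End.mul_apply, L.Q_baseChange_exp_smul_N, hGQ,
    L.neg_smul_N, L.Q_baseChange_exp_smul_N]

/-! ## §3 (2.3.2) for `Φ`: the period map takes values in `D` for `Im z ≫ 0` -/

/-- **`Φ(z) ∈ D` for `Im z ≥ A`, `|Re z| ≤ R`**: there is a Hodge structure of weight `k` on `V` whose Hodge filtration is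
`Φ(z) = exp(zN)·G(z)·F`, polarized by `Q` — the openness of `D ⊂ Ď` at the point `θ(z) ∈ D` (the tree's
`Polarization.exists_hodgeStructure_polarization_of_hodgeNorm_sub_le`, `‖g_z − 1‖_{θ(z)} ≤ 1/16`) and `g_z ∈ Aut(Q_ℂ)`.  («as soon as
`inf(y) ≥ C₂`, `Φ_nil(z)` defines a Hodge structure» — and so does the nearby `Φ(z)`; in the source `Φ(z) ∈ D` is the standing
assumption of a variation of Hodge structure.) [cite: CattaniDeligneKaplan1995, 2.2 (2.2.2) and 2.3 (2.3.2)–(2.3.3) (p. 487)]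
[cite: CarlsonMullerStachPeters2017, Prop. 4.4.2] -/
theorem exists_forall_exists_hodgeStructure_polarization_periodMap (G : ℂ → Module.End ℂ (ℂ ⊗[ℚ] V)) {C γ A₀ : ℝ} (hC : 0 ≤ C)
    (hγ : 0 < γ) (hG : ∀ z : ℂ, A₀ ≤ z.im → ∀ w, L.referenceNorm (G z w - w) ≤ C * Real.exp (-γ * z.im) * L.referenceNorm w)
    (hGQ : ∀ z x y, L.Q.baseChange ℂ (G z x) (G z y) = L.Q.baseChange ℂ x y) (R : ℝ) :
    ∃ A : ℝ, L.normThreshold < A ∧ ∀ z : ℂ, A ≤ z.im → |z.re| ≤ R →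
      ∃ H : HodgeStructure V k, (∀ q, H.F q = ((L.F q).map (G z)).map (IsNilpotent.exp (z • L.N.baseChange ℂ))) ∧
        ∃ P : H.Polarization, P.form = L.Q := by
  obtain ⟨D, hD, m, hDm⟩ := L.exists_forall_hodgeNorm_conj_sub_le G hC hG R
  obtain ⟨A₂, hA₂⟩ := exists_forall_pow_mul_exp_le' hγ m (ε := 1 / (16 * (D + 1))) (by positivity)
  refine ⟨max (max A₀ A₂) (L.normThreshold + 1), lt_of_lt_of_le (lt_add_one _) (le_max_right _ _), fun z hAz hRz => ?_⟩
  have hz : L.normThreshold < z.im := lt_of_lt_of_le (lt_of_lt_of_le (lt_add_one _) (le_max_right _ _)) hAz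
  have hA₀z : A₀ ≤ z.im := ((le_max_left _ _).trans (le_max_left _ _)).trans hAz
  have hA₂z : A₂ ≤ z.im := ((le_max_right _ _).trans (le_max_left _ _)).trans hAz
  set Pz := L.nilpotentOrbitPolarization z (L.orbitThreshold_lt_im hz) with hPz_def
  set g := IsNilpotent.exp (z • L.N.baseChange ℂ) * G z * IsNilpotent.exp (-(z • L.N.baseChange ℂ)) with hg_def
  have hη : D * z.im ^ m * Real.exp (-γ * z.im) ≤ 1 / 16 := by
    have h := hA₂ z.im hA₂z
    have hq : 0 < D + 1 := by positivity
    calc D * z.im ^ m * Real.exp (-γ * z.im) = D * (z.im ^ m * Real.exp (-γ * z.im)) := by ring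
      _ ≤ D * (1 / (16 * (D + 1))) := mul_le_mul_of_nonneg_left h hD
      _ = D / (D + 1) / 16 := by field_simp
      _ ≤ 1 / 16 := by have : D / (D + 1) ≤ 1 := (div_le_one hq).2 (by linarith); linarith
  have hu : ∀ x, Pz.hodgeNorm (g x - x) ≤ 1 / 16 * Pz.hodgeNorm x := fun x =>
    (hDm z hz hA₀z hRz x).trans (mul_le_mul_of_nonneg_right hη (Pz.hodgeNorm_nonneg x))
  have hHR : ∀ q : ℤ, ∀ x ∈ (L.nilpotentOrbit z (L.orbitThreshold_lt_im hz)).F q,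
      ∀ y ∈ (L.nilpotentOrbit z (L.orbitThreshold_lt_im hz)).F (k + 1 - q), Pz.form.baseChange ℂ (g x) (g y) = 0 := by
    intro q x hx y hy
    rw [L.nilpotentOrbitPolarization_form, hg_def, L.Q_baseChange_conj_apply G hGQ, ← L.nilpotentOrbitPolarization_form z (L.orbitThreshold_lt_im hz)]
    exact Pz.form_apply_eq_zero q x hx y hy
  obtain ⟨H, hHF, P, hP⟩ := Pz.exists_hodgeStructure_polarization_of_hodgeNorm_sub_le g hu hHR
  refine ⟨H, fun q => ?_, P, by rw [hP, L.nilpotentOrbitPolarization_form]⟩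
  rw [hHF q, L.map_exp_map_eq_map_conj_nilpotentOrbit_F G (L.orbitThreshold_lt_im hz) q]

/-! ## §4 (2.3.3): exact Hodge-filtration vectors of `Φ(z)` are exponentially close to `F^pθ(z)` -/

/-- **For `v ∈ Φ^p(z)` (`Im z > β`, `Im z ≥ A`, `|Re z| ≤ R`) there is `f₀ ∈ F^pθ(z)` with `‖v − f₀‖_{θ(z)} ≤ 2D (Im z)^m e^{−γ Im z}‖v‖_{θ(z)}`**
(`v = g_z f₀`, `‖g_z f₀ − f₀‖ ≤ η‖f₀‖`, `η ≤ 1/2`): «The distance between `Φ(z)` and `Φ_nil(z)` … is `≤ C₃ e^{−2π inf(y)} inf(y)^{C₀}`.»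
[cite: CattaniDeligneKaplan1995, 2.3 (2.3.3) (p. 487) and 2.18 (p. 492)] [cite: Schmid1973, (4.12) (cite only)] -/
theorem exists_forall_exists_mem_nilpotentOrbit_F_hodgeNorm_sub_le (G : ℂ → Module.End ℂ (ℂ ⊗[ℚ] V)) {C γ A₀ : ℝ} (hC : 0 ≤ C)
    (hγ : 0 < γ) (hG : ∀ z : ℂ, A₀ ≤ z.im → ∀ w, L.referenceNorm (G z w - w) ≤ C * Real.exp (-γ * z.im) * L.referenceNorm w) (R : ℝ) :
    ∃ D : ℝ, 0 ≤ D ∧ ∃ m : ℕ, ∃ A : ℝ, ∀ (z : ℂ) (hz : L.normThreshold < z.im), A ≤ z.im → |z.re| ≤ R → ∀ (p : ℤ),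
      ∀ v ∈ ((L.F p).map (G z)).map (IsNilpotent.exp (z • L.N.baseChange ℂ)),
        ∃ f₀ ∈ (L.nilpotentOrbit z (L.orbitThreshold_lt_im hz)).F p,
          (L.nilpotentOrbitPolarization z (L.orbitThreshold_lt_im hz)).hodgeNorm (v - f₀) ≤
            2 * D * z.im ^ m * Real.exp (-γ * z.im) * (L.nilpotentOrbitPolarization z (L.orbitThreshold_lt_im hz)).hodgeNorm v := by
  obtain ⟨D, hD, m, hDm⟩ := L.exists_forall_hodgeNorm_conj_sub_le G hC hG R
  obtain ⟨A₂, hA₂⟩ := exists_forall_pow_mul_exp_le' hγ m (ε := 1 / (2 * (D + 1))) (by positivity)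
  refine ⟨D, hD, m, max A₀ A₂, fun z hz hAz hRz p v hv => ?_⟩
  have hA₀z : A₀ ≤ z.im := (le_max_left _ _).trans hAz
  have hA₂z : A₂ ≤ z.im := (le_max_right _ _).trans hAz
  have hz0 : 0 < z.im := L.im_pos_of_normThreshold_lt hz
  set Pz := L.nilpotentOrbitPolarization z (L.orbitThreshold_lt_im hz) with hPz_def
  set η := D * z.im ^ m * Real.exp (-γ * z.im) with hη_def
  have hη0 : 0 ≤ η := by positivity
  have hη2 : η ≤ 1 / 2 := by
    have h := hA₂ z.im hA₂z
    have hq : 0 < D + 1 := by positivity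
    calc η = D * (z.im ^ m * Real.exp (-γ * z.im)) := by rw [hη_def]; ring
      _ ≤ D * (1 / (2 * (D + 1))) := mul_le_mul_of_nonneg_left h hD
      _ = D / (D + 1) / 2 := by field_simp
      _ ≤ 1 / 2 := by have : D / (D + 1) ≤ 1 := (div_le_one hq).2 (by linarith); linarith
  rw [L.map_exp_map_eq_map_conj_nilpotentOrbit_F G (L.orbitThreshold_lt_im hz) p] at hv
  obtain ⟨f₀, hf₀, rfl⟩ := hv
  refine ⟨f₀, hf₀, ?_⟩
  set g := IsNilpotent.exp (z • L.N.baseChange ℂ) * G z * IsNilpotent.exp (-(z • L.N.baseChange ℂ)) with hg_def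
  have h1 : Pz.hodgeNorm (g f₀ - f₀) ≤ η * Pz.hodgeNorm f₀ := hDm z hz hA₀z hRz f₀
  -- `‖f₀‖ ≤ ‖g f₀‖ + ‖g f₀ − f₀‖ ≤ ‖g f₀‖ + ½‖f₀‖`, so `‖f₀‖ ≤ 2‖g f₀‖`
  have h2 : Pz.hodgeNorm f₀ ≤ 2 * Pz.hodgeNorm (g f₀) :=
    Pz.hodgeNorm_le_two_mul_of_hodgeNorm_sub_le hη2 h1
  calc Pz.hodgeNorm (g f₀ - f₀) ≤ η * Pz.hodgeNorm f₀ := h1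
    _ ≤ η * (2 * Pz.hodgeNorm (g f₀)) := mul_le_mul_of_nonneg_left h2 hη0
    _ = 2 * D * z.im ^ m * Real.exp (-γ * z.im) * Pz.hodgeNorm (g f₀) := by rw [hη_def]; ring

/-- **The exponential form: `v ∈ Φ^p(z)` ⟹ `v ∼_{γ/2, z} F^pθ(z)`** — some `f₀ ∈ F^pθ(z)` has `‖v − f₀‖_{θ(z)} ≤ e^{−(γ/2) Im z}‖v‖_{θ(z)}` for
`Im z ≥ A` (`2D y^m e^{−γy} ≤ e^{−γy/2}` for large `y`): the exact Hodge filtration of `Φ` is approximately that of `Φ_nil` in the sense of 2.15.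
[cite: CattaniDeligneKaplan1995, 2.3 (2.3.3) (p. 487), 2.15 (p. 491), 2.18 (p. 492)] -/
theorem exists_forall_exists_mem_nilpotentOrbit_F_hodgeNorm_sub_le_exp (G : ℂ → Module.End ℂ (ℂ ⊗[ℚ] V)) {C γ A₀ : ℝ} (hC : 0 ≤ C)
    (hγ : 0 < γ) (hG : ∀ z : ℂ, A₀ ≤ z.im → ∀ w, L.referenceNorm (G z w - w) ≤ C * Real.exp (-γ * z.im) * L.referenceNorm w) (R : ℝ) :
    ∃ A : ℝ, ∀ (z : ℂ) (hz : L.normThreshold < z.im), A ≤ z.im → |z.re| ≤ R → ∀ (p : ℤ),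
      ∀ v ∈ ((L.F p).map (G z)).map (IsNilpotent.exp (z • L.N.baseChange ℂ)),
        ∃ f₀ ∈ (L.nilpotentOrbit z (L.orbitThreshold_lt_im hz)).F p,
          (L.nilpotentOrbitPolarization z (L.orbitThreshold_lt_im hz)).hodgeNorm (v - f₀) ≤
            Real.exp (-(γ / 2) * z.im) * (L.nilpotentOrbitPolarization z (L.orbitThreshold_lt_im hz)).hodgeNorm v := by
  obtain ⟨D, hD, m, A, h⟩ := L.exists_forall_exists_mem_nilpotentOrbit_F_hodgeNorm_sub_le G hC hγ hG R
  obtain ⟨A₂, hA₂⟩ := exists_forall_pow_mul_exp_le' (half_pos hγ) m (ε := 1 / (2 * D + 1)) (by positivity)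
  refine ⟨max A A₂, fun z hz hAz hRz p v hv => ?_⟩
  obtain ⟨f₀, hf₀, hle⟩ := h z hz ((le_max_left _ _).trans hAz) hRz p v hv
  refine ⟨f₀, hf₀, hle.trans (mul_le_mul_of_nonneg_right ?_ (HodgeStructure.Polarization.hodgeNorm_nonneg _ _))⟩
  -- `2D y^m e^{−γy} = (2D y^m e^{−γy/2}) e^{−γy/2} ≤ e^{−γy/2}`
  have hsplit : Real.exp (-γ * z.im) = Real.exp (-(γ / 2) * z.im) * Real.exp (-(γ / 2) * z.im) := by
    rw [← Real.exp_add]; ring_nf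
  have h2 := hA₂ z.im ((le_max_right _ _).trans hAz)
  have hq : 0 < 2 * D + 1 := by positivity
  have h3 : 2 * D * (z.im ^ m * Real.exp (-(γ / 2) * z.im)) ≤ 1 :=
    calc 2 * D * (z.im ^ m * Real.exp (-(γ / 2) * z.im)) ≤ 2 * D * (1 / (2 * D + 1)) := mul_le_mul_of_nonneg_left h2 (by positivity)
      _ = 2 * D / (2 * D + 1) := by field_simp
      _ ≤ 1 := (div_le_one hq).2 (by linarith)
  calc 2 * D * z.im ^ m * Real.exp (-γ * z.im)
      = 2 * D * (z.im ^ m * Real.exp (-(γ / 2) * z.im)) * Real.exp (-(γ / 2) * z.im) := by rw [hsplit]; ring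
    _ ≤ 1 * Real.exp (-(γ / 2) * z.im) := mul_le_mul_of_nonneg_right h3 (Real.exp_pos _).le
    _ = Real.exp (-(γ / 2) * z.im) := one_mul _

/-! ## §5 Cattani–Deligne–Kaplan, Theorem 2.5, for the period map `Φ` (`r = 1`) -/

/-- **CDK THEOREM 2.5 FOR A ONE-VARIABLE PERIOD MAP IN ASYMPTOTIC NORMAL FORM.**  Let `L = (W, F, N, Q)` be a polarized limit mixed
Hodge structure of weight `k = p + p` on the finite-dimensional `ℚ`-space `V`, `θ(z) = exp(zN)·F` its nilpotent orbit, `G : ℂ → End(V_ℂ)`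
with `|G(z)w − w|₀ ≤ C e^{−γ Im z}|w|₀` for `Im z ≥ A₀` (`γ > 0`), `Φ^p(z) = exp(zN)·G(z)·F^p` the Hodge filtration of the period map,
`Λ ⊆ V` a finitely generated subgroup, `K`, `R` reals.  There is `A₁ > β` such that for every `u ∈ Λ` with `Q(u, u) ≤ K` which lies in
`Φ^p(z)` (i.e. is of type `(p, p)` for `Φ(z)`, `u` being real) at SOME point with `Im z ≥ A₁`, `|Re z| ≤ R`:
**(ii) `u ∈ W_k`, `N u = 0`, `1 ⊗ u ∈ F^p` (a limiting Hodge filtration) and `u ∈ H^{p,p}(θ(z'))` at every point `z'` of the nilpotent orbit;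
(i) the set of such `u` is FINITE.**  Proof: `1 ⊗ u ∼_{γ/2,z} F^pθ(z)` (§4) with `‖1 ⊗ u‖_{θ(z)} ≤ √(3K)` (2.17 (iii)), and Thm. 2.16 for
the nilpotent orbit. [cite: CattaniDeligneKaplan1995, Thm. 2.5 (p. 488), 2.3 (2.3.3), 2.15–2.19 (pp. 491–493), §4 (pp. 499–505)]
[cite: Schmid1973, (4.12), Thm. (6.6) (cite only)] -/
theorem exists_threshold_integral_hodgeClasses_periodMap {p : ℤ} (hpk : p + p = k) (G : ℂ → Module.End ℂ (ℂ ⊗[ℚ] V))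
    {C γ A₀ : ℝ} (hC : 0 ≤ C) (hγ : 0 < γ)
    (hG : ∀ z : ℂ, A₀ ≤ z.im → ∀ w, L.referenceNorm (G z w - w) ≤ C * Real.exp (-γ * z.im) * L.referenceNorm w)
    (Λ : Submodule ℤ V) (hΛ : Λ.FG) (K R : ℝ) :
    ∃ A₁ : ℝ, L.normThreshold < A₁ ∧
      (∀ u ∈ Λ, ((L.Q u u : ℚ) : ℝ) ≤ K → ∀ (z : ℂ), L.normThreshold < z.im → A₁ ≤ z.im → |z.re| ≤ R →
        ofRat u ∈ ((L.F p).map (G z)).map (IsNilpotent.exp (z • L.N.baseChange ℂ)) →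
        u ∈ L.W k ∧ L.N u = 0 ∧ ofRat u ∈ L.F p ∧
          ∀ (z' : ℂ) (hz' : L.orbitThreshold < z'.im), ofRat u ∈ (L.nilpotentOrbit z' hz').piece p p) ∧
      {u : V | u ∈ Λ ∧ ((L.Q u u : ℚ) : ℝ) ≤ K ∧ ∃ (z : ℂ), L.normThreshold < z.im ∧ A₁ ≤ z.im ∧ |z.re| ≤ R ∧
        ofRat u ∈ ((L.F p).map (G z)).map (IsNilpotent.exp (z • L.N.baseChange ℂ))}.Finite := by
  obtain ⟨A_c, hclose⟩ := L.exists_forall_exists_mem_nilpotentOrbit_F_hodgeNorm_sub_le_exp G hC hγ hG R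
  obtain ⟨A₂, hA₂, h216, hfin⟩ := L.exists_threshold_approximate_integral_hodgeClasses hpk Λ hΛ (Real.sqrt (3 * K)) R (half_pos hγ)
  obtain ⟨A₃, hA₃⟩ := exists_forall_pow_mul_exp_le' (half_pos hγ) 0 (ε := 1 / 8) (by norm_num)
  -- the data at a point: closeness and the norm bound
  have key : ∀ u : V, ((L.Q u u : ℚ) : ℝ) ≤ K → ∀ (z : ℂ) (hz : L.normThreshold < z.im), max (max A_c A₂) A₃ ≤ z.im → |z.re| ≤ R →
      ofRat u ∈ ((L.F p).map (G z)).map (IsNilpotent.exp (z • L.N.baseChange ℂ)) →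
      (L.nilpotentOrbitPolarization z (L.orbitThreshold_lt_im hz)).hodgeNorm (ofRat u) ≤ Real.sqrt (3 * K) ∧
      ∃ f ∈ (L.nilpotentOrbit z (L.orbitThreshold_lt_im hz)).F p,
        (L.nilpotentOrbitPolarization z (L.orbitThreshold_lt_im hz)).hodgeNorm (ofRat u - f) ≤
          Real.exp (-(γ / 2) * z.im) * (L.nilpotentOrbitPolarization z (L.orbitThreshold_lt_im hz)).hodgeNorm (ofRat u) := by
    intro u hK z hz hAz hRz hu
    obtain ⟨f₀, hf₀, hle⟩ := hclose z hz (((le_max_left _ _).trans (le_max_left _ _)).trans hAz) hRz p (ofRat u) hu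
    have hexp8 : Real.exp (-(γ / 2) * z.im) ≤ 1 / 8 := by
      have h := hA₃ z.im ((le_max_right _ _).trans hAz)
      rwa [pow_zero, one_mul] at h
    refine ⟨?_, f₀, hf₀, hle⟩
    have h := (L.nilpotentOrbitPolarization z (L.orbitThreshold_lt_im hz)).hodgeNorm_ofRat_le_sqrt_of_form_le hpk hf₀ hle
      (Real.exp_pos _).le hexp8 (K := K) (by rw [L.nilpotentOrbitPolarization_form]; exact hK)
    exact h
  refine ⟨max (max A_c A₂) A₃, lt_of_lt_of_le hA₂ ((le_max_right _ _).trans (le_max_left _ _)), fun u hu hK z hz hAz hRz hmem => ?_,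
    hfin.subset ?_⟩
  · obtain ⟨hnorm, happ⟩ := key u hK z hz hAz hRz hmem
    exact h216 u hu z hz (((le_max_right _ _).trans (le_max_left _ _)).trans hAz) hRz hnorm happ
  · rintro u ⟨hu, hK, z, hz, hAz, hRz, hmem⟩
    obtain ⟨hnorm, happ⟩ := key u hK z hz hAz hRz hmem
    exact ⟨hu, z, hz, ((le_max_right _ _).trans (le_max_left _ _)).trans hAz, hRz, hnorm, happ⟩

end PolarizedLimitMixedHodgeStructure

end HodgeTheory

end Literature.AlgebraicGeometry

end
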